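import Summits.PneNP.PneNP.Theorems.SzkEntropyPeaThreeNotInPLatticeDefs
import Literature.InformationTheory.Entropy.MapEntropyPi
import HarnessLib

/-!
# Crux `PeaThreeNotInP` (stmt-PneNP-10776), line `SketchIdeator3`, socket client
# `lattice-cube-smoothing`: stub `stub_reindex` (re-indexing the input bits by `(b, z, e)`)

The decoders `ext` / `bitsVal` of the definitions file read the input `u : Fin N → F₂`
(`N = n ℓ + n m + 1`) as a triple `(b, z, e)`: the bit `b = u 0`, the coefficients
`z_{i'} = bitsVal u (1 + i' ℓ) ℓ < 2^ℓ` and the noise coordinates `e_i = bitsVal u (1 + n ℓ + i m) m < 2^m`.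
This decoding `D : (Fin N → F₂) → Bool × Box n ℓ m` is a bijection (injective: an input is determined
by its bits, every bit is `b` or a bit of some `z_{i'}` or of some `e_i`, and a block value
`bitsVal u start len` determines the `len` bits it reads; then the two sides have the same
cardinality `2^N`), and along it the bit-level samplers `yP`, `(yQ, b)` become the typed samplers
`(b ? f : g)(z, e)` and `(g(z, e), b)`.  Entropy of the image of a uniform distribution is invariant
under re-indexing the sample space by a bijection (`mapEntropy_univ_comp_equiv`), and
`H((g(z,e), b)) = H(g) + H(b) = H(g) + 1` by additivity on independent pairs (`mapEntropy_product`).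

All statements here are elementary bookkeeping ("folklore"); the entropy API is
`Literature/InformationTheory/Entropy/MapEntropy.lean`, `MapEntropyPi.lean`.
-/

namespace Summit.PneNP.PneNP.Cruxes.PeaThreeNotInP.LatticeLine

set_option linter.dupNamespace false -- `Summit.PneNP.PneNP.…`: summit = sub-problem name (D-0017)

open Finset
open Literature.InformationTheory.Entropy

/-! ### The block value `bitsVal` -/

/-- Peeling the top bit of a block: `bitsVal u start (len + 1) = bitsVal u start len + [u (start + len)] 2^len`.
[folklore] -/
theorem reidx_bitsVal_succ (u : ℕ → Bool) (start len : ℕ) :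
    bitsVal u start (len + 1) = bitsVal u start len + if u (start + len) then 2 ^ len else 0 := by
  unfold bitsVal
  rw [Finset.sum_range_succ]

/-- A block of `len` bits encodes a number `< 2^len`. [folklore] -/
theorem reidx_bitsVal_lt (u : ℕ → Bool) (start len : ℕ) : bitsVal u start len < 2 ^ len := by
  induction len with
  | zero => simp [bitsVal]
  | succ len ih =>
    rw [reidx_bitsVal_succ, pow_succ]
    split_ifs <;> omega

/-- The value of a block determines the bits of the block. [folklore] -/
theorem reidx_bitsVal_inj (u u' : ℕ → Bool) (start len : ℕ)
    (h : bitsVal u start len = bitsVal u' start len) : ∀ s < len, u (start + s) = u' (start + s) := by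
  induction len with
  | zero => intro s hs; omega
  | succ len ih =>
    rw [reidx_bitsVal_succ, reidx_bitsVal_succ] at h
    have h1 := reidx_bitsVal_lt u start len
    have h2 := reidx_bitsVal_lt u' start len
    have htop : u (start + len) = u' (start + len) ∧ bitsVal u start len = bitsVal u' start len := by
      revert h
      cases u (start + len) <;> cases u' (start + len) <;>
        simp only [Bool.false_eq_true, if_false, if_true, add_zero, true_and] <;> intro h <;> omega
    intro s hs
    rcases Nat.lt_succ_iff_lt_or_eq.1 hs with hs' | rfl
    · exact ih htop.2 s hs'
    · exact htop.1

/-! ### Inputs are determined by their bits -/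

/-- Two inputs with the same bits below `N` are equal. [folklore] -/
theorem reidx_eq_of_ext_eq {N : ℕ} (x x' : Fin N → ZMod 2) (h : ∀ k < N, ext x k = ext x' k) : x = x' := by
  have key : ∀ a b : ZMod 2, (a = 1 ↔ b = 1) → a = b := by decide
  funext k
  have hk := h k k.2
  simp only [ext, dif_pos k.2, Fin.eta, decide_eq_decide] at hk
  exact key _ _ hk

/-! ### The decoder `(b, z, e)` of an input -/

/-- **The decoder exists**: a map `D : (Fin N → F₂) → Bool × Box n ℓ m` reading `b = u 0`,
`z_{i'} = bitsVal u (1 + i' ℓ) ℓ` and `e_i = bitsVal u (1 + n ℓ + i m) m` (well-typed by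
`reidx_bitsVal_lt`). [folklore] -/
theorem reidx_exists_decoder (c : CVPTup) (n : ℕ) :
    ∃ D : (Fin c.N → ZMod 2) → Bool × Box n c.ℓ c.m,
      (∀ x, (D x).1 = ext x 0) ∧
      (∀ x (i' : Fin n), ((D x).2.1 i' : ℕ) = bitsVal (ext x) (1 + i' * c.ℓ) c.ℓ) ∧
      (∀ x (i : Fin n), ((D x).2.2 i : ℕ) = bitsVal (ext x) (1 + c.n * c.ℓ + i * c.m) c.m) :=
  ⟨fun x => (ext x 0, (fun i' => ⟨_, reidx_bitsVal_lt (ext x) (1 + i' * c.ℓ) c.ℓ⟩,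
    fun i => ⟨_, reidx_bitsVal_lt (ext x) (1 + c.n * c.ℓ + i * c.m) c.m⟩)),
    fun _ => rfl, fun _ _ => rfl, fun _ _ => rfl⟩

/-- **The decoder is injective**: every input bit `k < N = n ℓ + n m + 1` is the bit `b` (`k = 0`),
bit `s` of `z_{i'}` (`k = 1 + i' ℓ + s`) or bit `s` of `e_i` (`k = 1 + n ℓ + i m + s`), and each block
value determines its bits. [folklore] -/
theorem reidx_decoder_injective (c : CVPTup) {D : (Fin c.N → ZMod 2) → Bool × Box c.n c.ℓ c.m}
    (h0 : ∀ x, (D x).1 = ext x 0)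
    (hz : ∀ x (i' : Fin c.n), ((D x).2.1 i' : ℕ) = bitsVal (ext x) (1 + i' * c.ℓ) c.ℓ)
    (he : ∀ x (i : Fin c.n), ((D x).2.2 i : ℕ) = bitsVal (ext x) (1 + c.n * c.ℓ + i * c.m) c.m) :
    Function.Injective D := by
  intro x x' hxx
  refine reidx_eq_of_ext_eq x x' fun k hk => ?_
  simp only [CVPTup.N, CVPTup.nzE] at hk
  rcases Nat.eq_zero_or_pos k with rfl | hk0
  · rw [← h0, ← h0, hxx]
  by_cases hkz : k < 1 + c.n * c.ℓ
  · -- bit `s` of `z_{i'}`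
    have hℓ : 0 < c.ℓ := by
      rcases Nat.eq_zero_or_pos c.ℓ with h | h
      · rw [h, mul_zero] at hkz; omega
      · exact h
    have hi' : (k - 1) / c.ℓ < c.n := (Nat.div_lt_iff_lt_mul hℓ).2 (by omega)
    have hs : (k - 1) % c.ℓ < c.ℓ := Nat.mod_lt _ hℓ
    have hk' : k = 1 + (k - 1) / c.ℓ * c.ℓ + (k - 1) % c.ℓ := by
      have := Nat.div_add_mod' (k - 1) c.ℓ
      omega
    have hblk : bitsVal (ext x) (1 + (k - 1) / c.ℓ * c.ℓ) c.ℓ = bitsVal (ext x') (1 + (k - 1) / c.ℓ * c.ℓ) c.ℓ := by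
      have h1 := hz x ⟨_, hi'⟩
      have h2 := hz x' ⟨_, hi'⟩
      dsimp only at h1 h2
      rw [← h1, ← h2, hxx]
    have := reidx_bitsVal_inj _ _ _ _ hblk _ hs
    rwa [← hk'] at this
  · -- bit `s` of `e_i`
    have hm : 0 < c.m := by
      rcases Nat.eq_zero_or_pos c.m with h | h
      · rw [h, mul_zero] at hk; omega
      · exact h
    have hi : (k - 1 - c.n * c.ℓ) / c.m < c.n := (Nat.div_lt_iff_lt_mul hm).2 (by omega)
    have hs : (k - 1 - c.n * c.ℓ) % c.m < c.m := Nat.mod_lt _ hm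
    have hk' : k = 1 + c.n * c.ℓ + (k - 1 - c.n * c.ℓ) / c.m * c.m + (k - 1 - c.n * c.ℓ) % c.m := by
      have := Nat.div_add_mod' (k - 1 - c.n * c.ℓ) c.m
      omega
    have hblk : bitsVal (ext x) (1 + c.n * c.ℓ + (k - 1 - c.n * c.ℓ) / c.m * c.m) c.m =
        bitsVal (ext x') (1 + c.n * c.ℓ + (k - 1 - c.n * c.ℓ) / c.m * c.m) c.m := by
      have h1 := he x ⟨_, hi⟩
      have h2 := he x' ⟨_, hi⟩
      dsimp only at h1 h2
      rw [← h1, ← h2, hxx]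
    have := reidx_bitsVal_inj _ _ _ _ hblk _ hs
    rwa [← hk'] at this

/-- **The decoder is a bijection**: injective between finite types of the same cardinality
`2^N = 2 · (2^ℓ)ⁿ · (2^m)ⁿ`. [folklore] -/
theorem reidx_decoder_bijective (c : CVPTup) {D : (Fin c.N → ZMod 2) → Bool × Box c.n c.ℓ c.m}
    (h0 : ∀ x, (D x).1 = ext x 0)
    (hz : ∀ x (i' : Fin c.n), ((D x).2.1 i' : ℕ) = bitsVal (ext x) (1 + i' * c.ℓ) c.ℓ)
    (he : ∀ x (i : Fin c.n), ((D x).2.2 i : ℕ) = bitsVal (ext x) (1 + c.n * c.ℓ + i * c.m) c.m) :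
    Function.Bijective D := by
  rw [Fintype.bijective_iff_injective_and_card]
  refine ⟨reidx_decoder_injective c h0 hz he, ?_⟩
  rw [Fintype.card_fun, Fintype.card_prod, Fintype.card_prod, Fintype.card_fun, Fintype.card_fun]
  simp only [ZMod.card, Fintype.card_fin, Fintype.card_bool]
  simp only [CVPTup.N, CVPTup.nzE]
  rw [pow_succ, pow_add, pow_mul', pow_mul']
  ring

/-! ### Entropy bookkeeping -/

/-- **Transport of entropy along a bijective re-indexing**: if `D` is a bijection and
`F = G ∘ D` then `H(F(U)) = H(G(U))`. [folklore] -/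
theorem reidx_mapEntropy_transport {α γ β : Type*} [Fintype α] [Fintype γ] [DecidableEq β]
    {D : α → γ} (hD : Function.Bijective D) (F : α → β) (G : γ → β) (h : ∀ x, F x = G (D x)) :
    mapEntropy univ F = mapEntropy univ G := by
  have hF : F = G ∘ (Equiv.ofBijective D hD) := funext fun x => h x
  rw [hF]
  exact mapEntropy_univ_comp_equiv _ _

/-- **An independent uniform bit adds one bit of entropy**: `H((g(z), b)) = H(g(z)) + 1` for
`(b, z)` uniform on `Bool × γ`. [folklore] -/
theorem reidx_mapEntropy_pair_bool {γ β : Type*} [Fintype γ] [Nonempty γ] [DecidableEq β] (g : γ → β) :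
    mapEntropy (univ : Finset (Bool × γ)) (fun p => (g p.2, p.1)) = mapEntropy univ g + 1 := by
  have hker : mapEntropy (univ : Finset (Bool × γ)) (fun p => (g p.2, p.1)) =
      mapEntropy univ (Prod.map id g) :=
    mapEntropy_univ_eq_of_ker_eq fun ⟨b, z⟩ ⟨b', z'⟩ => by
      simp only [Prod.map_apply, id_eq, Prod.mk.injEq]
      exact and_comm
  rw [hker, ← Finset.univ_product_univ, mapEntropy_product univ_nonempty univ_nonempty,
    mapEntropy_of_injective _ Function.injective_id, Finset.card_univ, Fintype.card_bool, Nat.cast_ofNat,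
    Real.logb_self_eq_one one_lt_two, add_comm]

/-! ### The stub -/

/-- **(W2) Re-indexing.**  Along the bijective decoding `u ↦ (b, z, e)` of the `N = n ℓ + n m + 1`
input bits, the bit-level sampler `yP` is the typed sampler `b ? f(z, e) : g(z, e)` and `(yQ, b)` is
`(g(z, e), b)`; hence `H(yP) = H(b ? f : g)` and `H((yQ, b)) = H(g) + 1` (an independent uniform bit).
[folklore] -/
theorem stub_reindex (c : CVPTup) (n : ℕ) (B : Matrix (Fin n) (Fin n) ℤ) (t : Fin n → ℤ) (hn : c.n = n) (hB : ∀ i' i : Fin n, c.entry i' i = B i' i) (ht : ∀ i : Fin n, c.tgt i = t i) : mapEntropy Finset.univ (fun x : Fin c.N → ZMod 2 => fun i : Fin n => c.yP (ext x) i) = mapEntropy (Finset.univ : Finset (Bool × Box n c.ℓ c.m)) (fun p => if p.1 then sampF n c.K B t p.2 else sampG n c.K B p.2) ∧ mapEntropy Finset.univ (fun x : Fin c.N → ZMod 2 => ((fun i : Fin n => c.yQ (ext x) i), ext x 0)) = mapEntropy (Finset.univ : Finset (Box n c.ℓ c.m)) (sampG n c.K B) + 1 := by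
  subst hn
  obtain ⟨D, h0, hz, he⟩ := reidx_exists_decoder c c.n
  have hbij : Function.Bijective D := reidx_decoder_bijective c h0 hz he
  have hQ : ∀ x (i : Fin c.n), c.yQ (ext x) i = sampG c.n c.K B (D x).2 i := by
    intro x i
    simp only [CVPTup.yQ, sampG, Finset.sum_range, hz, he, hB]
  have hP : ∀ x, (fun i : Fin c.n => c.yP (ext x) i) =
      (fun p : Bool × Box c.n c.ℓ c.m => if p.1 then sampF c.n c.K B t p.2 else sampG c.n c.K B p.2) (D x) := by
    intro x
    funext i
    simp only [CVPTup.yP, h0]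
    split_ifs with hb
    · rw [sampF, hQ, ht]
    · rw [hQ, add_zero]
  haveI : Nonempty (Box c.n c.ℓ c.m) :=
    ⟨(fun _ => ⟨0, Nat.two_pow_pos _⟩, fun _ => ⟨0, Nat.two_pow_pos _⟩)⟩
  refine ⟨reidx_mapEntropy_transport hbij _ _ hP, ?_⟩
  have e2 : mapEntropy univ (fun x : Fin c.N → ZMod 2 => ((fun i : Fin c.n => c.yQ (ext x) i), ext x 0)) =
      mapEntropy univ (fun p : Bool × Box c.n c.ℓ c.m => (sampG c.n c.K B p.2, p.1)) :=
    reidx_mapEntropy_transport hbij _ _ fun x => by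
      simp only [Prod.mk.injEq]
      exact ⟨funext (hQ x), (h0 x).symm⟩
  rw [e2, reidx_mapEntropy_pair_bool]

end Summit.PneNP.PneNP.Cruxes.PeaThreeNotInP.LatticeLine
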